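import Literature.AnabelianGeometry.EtaleTheta.BiKummerThm44Sub
import Literature.AnabelianGeometry.EtaleTheta.Discharge.Sec4Thm44ii

/-!
# [EtTh] Theorem 4.4 (ii)(iii): derivations of the sub-DAG compositions (proof-only companion)

S. Mochizuki, *The étale theta function …*, Publ. RIMS **45** (2009) [MochizukiEtTh2009], §4, Thm 4.4, proof
PDF p.95 (printed p.321).  Proof-only companion of the sub-DAG statements file `BiKummerThm44Sub.lean`
(`plan/L2/SUBDAG-EtTh-Thm44.md`, rows `EtTh:Thm4.4(·)/T44-L…`): the compositions of the printed proof of (ii)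
and (iii) that are formal over the present two-field §4 interface —
* `thm44_ii_of_subnodes`: `Thm44_ii` ("`Ψ` preserves fraction-pairs") ⇐ T44-L03 (pre-steps) + T44-L10 (b)
  (`Ψ^birat` vs fractions) + T44-L12 (disjoint supports) — by `thm44_ii_of` (`Discharge/Sec4Thm44ii`, abc-iut-L2-t3);
* `thm44_ii_left_of`: the left-fraction-pair clause of (ii) ⇐ `Thm44_ii` + T44-L10 (a);
* `preservesFixedByHA_of`: T44-L15a ⇐ T44-L09c + T44-L10 (c) (`Ψ` full, `Ψ^bs` faithful);
* `preservesSaturated_of`: T44-L15 (⇒) ⇐ T44-L03 + T44-L05 + T44-L15b + multiplicativity of `ψ`;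
* `thm44_iii_of`: `Thm44_iii` (v5, saturation clause) ASSEMBLED from its two directions.
HONEST FRAMING: refereed pre-IUT material; nothing here bears on [IUTchIII] Cor. 3.12; typed ≠ proved — the
named INPUT sub-nodes (T44-L03/L04/L09/L09c/L10/L12/L15b, `ReflectsSaturated`) remain hypotheses.
-/

namespace Literature.AnabelianGeometry.EtaleTheta

open CategoryTheory Opposite Literature.AlgebraicGeometry.Frobenioids

namespace BiKummerSetting

universe u₀ v₀ u v w

variable {K : Type u₀} [Field K] {K' : Type u₀} [Field K'] {D₀ : Type u₀} [Category.{v₀} D₀]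
  {V : FrdIMonoidStub.{w}}
  {X₁ : SemiGraphs.TemperedArithmeticGroup.{u₀} K} {X₂ : SemiGraphs.TemperedArithmeticGroup.{u₀} K'}
  {D₀' : Type u₀} [Category.{v₀} D₀']
  {T₁ : RealifiedDivisorMonoids (D₀ := D₀) V} {T₂ : RealifiedDivisorMonoids (D₀ := D₀') V}
  {D₁ D₂ : Type u} [Category.{v} D₁] [Category.{v} D₂] {VD₁ : FrdICatStub.{u, v, w} D₁}
  {VD₂ : FrdICatStub.{u, v, w} D₂} {S₁ : BiKummerSetting X₁ T₁ D₁ VD₁} {S₂ : BiKummerSetting X₂ T₂ D₂ VD₂}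

/-! ### (ii) -/

/-- **T44-L13 assembled from the named sub-nodes**: T44-L03 (pre-steps), T44-L10 (b) and T44-L12 are exactly
the three inputs of `thm44_ii_of` (`Discharge/Sec4Thm44ii`, owner abc-iut-L2-t3), giving `Thm44_ii` "`Ψ` preserves
fraction-pairs". [cite: MochizukiEtTh2009, Thm 4.4 p.95] -/
theorem Thm44Hyp.thm44_ii_of_subnodes (h : Thm44Hyp S₁ S₂)
    (ψ : ∀ A : S₁.C, S₁.biratUnits A ≃* S₂.biratUnits (h.Ψ.functor.obj A))
    (h3 : h.PreservesFrobeniusStructure) (h10 : h.BiratCompatible ψ) (h12 : h.PreservesDisjointSupports) :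
    Thm44_ii h ψ :=
  thm44_ii_of h ψ (fun _ hs => h.isPreStep_map h3 hs)
    (fun s' s'' h' h'' hb => h10.frac s' s'' h' h'' hb _ _ _) (fun s' s'' hd => h12 s' s'' hd)

/-- The left-fraction-pair clause ⇐ `Thm44_ii` + T44-L10 (a). [cite: MochizukiEtTh2009, Thm 4.4 p.95] -/
theorem Thm44Hyp.thm44_ii_left_of (h : Thm44Hyp S₁ S₂)
    (ψ : ∀ A : S₁.C, S₁.biratUnits A ≃* S₂.biratUnits (h.Ψ.functor.obj A))
    (hii : Thm44_ii h ψ) (h10 : h.BiratCompatible ψ) : Thm44_ii_left h ψ := by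
  intro A B f P
  obtain ⟨Q, hn, hd⟩ := hii f P
  refine ⟨Q, hn, hd, ?_⟩
  have key : ∀ (s : h.Ψ.functor.obj A ⟶ h.Ψ.functor.obj B) (ks : S₂.IsPreStep s),
      s = h.Ψ.functor.map P.num →
        S₂.restrictAlong s ks (ψ A f) = ψ B (S₁.restrictAlong P.num P.isPreStep_num f) := by
    rintro s ks rfl
    exact (h10.restrict P.num P.isPreStep_num ks f).symm
  exact key Q.num Q.isPreStep_num hn

/-! ### (iii) -/

/-- The transport `Aut_{D₁}(A^bs) → Aut_{D₂}((Ψ A)^bs)` is injective (`Ψ^bs` is faithful).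
[cite: MochizukiEtTh2009, Thm 4.4 p.94] -/
theorem Thm44Hyp.transportBaseAut_injective (h : Thm44Hyp S₁ S₂) (A : S₁.C) :
    Function.Injective (h.transportBaseAut A) := by
  intro σ τ hστ
  have e := congrArg Iso.hom hστ
  rw [h.transportBaseAut_hom, h.transportBaseAut_hom] at e
  exact Aut.ext (h.Ψbs.functor.map_injective ((cancel_mono _).1 ((cancel_epi _).1 e)))

/-- T44-L15a ⇐ T44-L09c + T44-L10 (c): an element of `H_{Ψ A}` is `Ψ(σ)` for some `σ ∈ Aut_{C₁}(A)` (`Ψ`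
full), which lies in `H_A` because its base image transports into `H_{Ψ A}^bs = Ψ^bs(H_A^bs)` (`Ψ^bs`
faithful); then `Ψ(σ)·ψ(f) = ψ(σ·f) = ψ(f)`. [cite: MochizukiEtTh2009, Thm 4.4 p.95] -/
theorem Thm44Hyp.preservesFixedByHA_of (h : Thm44Hyp S₁ S₂)
    (ψ : ∀ A : S₁.C, S₁.biratUnits A ≃* S₂.biratUnits (h.Ψ.functor.obj A))
    (h9 : h.GaloisCompatible) (h10 : h.BiratCompatible ψ) : h.PreservesFixedByHA ψ := by
  intro A hA hA' f hf σ₂ hσ₂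
  obtain ⟨hA'', hmap⟩ := h9 A hA
  obtain ⟨σ₁, rfl⟩ : ∃ σ₁ : Aut A, h.Ψ.functor.mapAut A σ₁ = σ₂ :=
    ⟨h.Ψ.functor.preimageIso σ₂, Iso.ext (h.Ψ.functor.map_preimage σ₂.hom)⟩
  have hmem : S₂.autBase _ (h.Ψ.functor.mapAut A σ₁) ∈ (S₁.HAbs A hA).map (h.transportBaseAut A) := by
    rw [hmap]; exact hσ₂
  rw [h.autBase_mapAut] at hmem
  obtain ⟨β, hβ, hβe⟩ := Subgroup.mem_map.1 hmem
  have hσ₁ : σ₁ ∈ S₁.HA A hA := by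
    show S₁.autBase A σ₁ ∈ S₁.HAbs A hA
    rw [← h.transportBaseAut_injective A hβe]; exact hβ
  rw [← h10.aut σ₁ f, hf σ₁ hσ₁]

/-- T44-L15 (⇒) ⇐ T44-L03 (pre-steps), T44-L05 (Frobenius-trivial, itself ⇐ T44-L03), T44-L15b, and
multiplicativity of `ψ` ((b): `(ψ g)^N = ψ (g^N)`). [cite: MochizukiEtTh2009, Thm 4.4 p.95] -/
theorem Thm44Hyp.preservesSaturated_of (h : Thm44Hyp S₁ S₂)
    (ψ : ∀ A : S₁.C, S₁.biratUnits A ≃* S₂.biratUnits (h.Ψ.functor.obj A))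
    (h3 : h.PreservesFrobeniusStructure) (h15 : h.PreservesNHSaturatedBsFld) : h.PreservesSaturated ψ := by
  intro A N f hA₂ hf₂ hsat
  obtain ⟨A', A'', s₁, s₂, hs₁, hs₂, hft, hNH⟩ := hsat.cond_a
  obtain ⟨g, hg⟩ := hsat.cond_b
  refine ⟨hA₂, hf₂, ⟨h.Ψ.functor.obj A', h.Ψ.functor.obj A'', h.Ψ.functor.map s₁, h.Ψ.functor.map s₂,
    h.isPreStep_map h3 hs₁, h.isPreStep_map h3 hs₂, h.preservesFrobeniusTrivial_of h3 _ hft,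
    (h15 A'' _ N hft (IsIsomorph.refl _)).1 hNH⟩, ⟨ψ A g, ?_⟩⟩
  rw [← map_pow, hg]

/-- **Thm 4.4 (iii) (saturation clause, v5) ASSEMBLED** from its two directions.
[cite: MochizukiEtTh2009, Thm 4.4 p.94] -/
theorem Thm44Hyp.thm44_iii_of (h : Thm44Hyp S₁ S₂)
    (ψ : ∀ A : S₁.C, S₁.biratUnits A ≃* S₂.biratUnits (h.Ψ.functor.obj A))
    (hP : h.PreservesSaturated ψ) (hR : h.ReflectsSaturated ψ) : Thm44_iii h ψ :=
  fun A N f hA₁ hf₁ hA₂ hf₂ => ⟨hP A N f hA₂ hf₂, hR A N f hA₁ hf₁⟩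

/-! ### (iii), converse direction: `Ψ` REFLECTS pre-steps and Frobenius-trivial objects; T44-L15r -/

/-- `Ψ` reflects base-isomorphisms (`Ψ^bs` is an equivalence, hence reflects isomorphisms).
[cite: MochizukiEtTh2009, Thm 4.4 p.95] -/
theorem Thm44Hyp.isBaseIso_of_map (h : Thm44Hyp S₁ S₂) {A B : S₁.C} {φ : A ⟶ B}
    (hφ : PreFrobenioid.IsBaseIso S₂.F (h.Ψ.functor.map φ)) : PreFrobenioid.IsBaseIso S₁.F φ := by
  have h1 : IsIso (S₂.base.map (h.Ψ.functor.map φ)) := hφ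
  rw [h.base_map_Ψ_cmp] at h1
  haveI : IsIso (h.Ψbs.functor.map (S₁.base.map φ) ≫ (h.cmp B).hom) :=
    IsIso.of_isIso_comp_left (h.cmp A).inv _
  haveI : IsIso (h.Ψbs.functor.map (S₁.base.map φ)) := IsIso.of_isIso_comp_right _ (h.cmp B).hom
  exact isIso_of_fully_faithful h.Ψbs.functor (S₁.base.map φ)

/-- `Ψ` reflects base-identity endomorphisms (`Ψ^bs` is faithful). [cite: MochizukiEtTh2009, Thm 4.4 p.95] -/
theorem Thm44Hyp.isBaseIdentity_of_map (h : Thm44Hyp S₁ S₂) {A : S₁.C} {φ : A ⟶ A}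
    (hφ : S₂.IsBaseIdentity (h.Ψ.functor.map φ)) : S₁.IsBaseIdentity φ := by
  have hφ' : S₂.base.map (h.Ψ.functor.map φ) = 𝟙 _ := hφ
  have e := h.base_map_Ψ_cmp φ
  rw [hφ'] at e
  have e3 := (Iso.eq_inv_comp _).1 e
  rw [Category.comp_id] at e3
  have e4 : 𝟙 _ ≫ (h.cmp A).hom = h.Ψbs.functor.map (S₁.base.map φ) ≫ (h.cmp A).hom := by
    rw [Category.id_comp]; exact e3
  have e2 : h.Ψbs.functor.map (S₁.base.map φ) = 𝟙 _ := ((cancel_mono _).1 e4).symm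
  show S₁.base.map φ = 𝟙 _
  exact h.Ψbs.functor.map_injective (e2.trans (h.Ψbs.functor.map_id _).symm)

/-- `Ψ` reflects pre-steps (Frobenius degrees agree by T44-L03; base-isomorphisms are reflected).
[cite: MochizukiEtTh2009, Thm 4.4 p.95] -/
theorem Thm44Hyp.isPreStep_of_map (h : Thm44Hyp S₁ S₂) (h3 : h.PreservesFrobeniusStructure) {A B : S₁.C}
    {φ : A ⟶ B} (hφ : S₂.IsPreStep (h.Ψ.functor.map φ)) : S₁.IsPreStep φ :=
  ⟨((h3.1 φ).symm.trans hφ.1 : S₁.degFr φ = 1), h.isBaseIso_of_map hφ.2⟩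

/-- `Ψ` reflects Frobenius-trivial objects, given that it reflects morphisms of Frobenius type (the [FrdI]
Thm 3.4 input for `Ψ⁻¹`; "for `i = 1, 2`", p.94): pull the section `ζ : ℕ_{≥1} → End(Ψ A)` back through the
fully faithful `Ψ`. [cite: MochizukiEtTh2009, Thm 4.4 p.95] -/
theorem Thm44Hyp.isFrobeniusTrivial_of_map (h : Thm44Hyp S₁ S₂) (h3 : h.PreservesFrobeniusStructure)
    (hrefl : ∀ ⦃A B : S₁.C⦄ (φ : A ⟶ B), S₂.IsFrobeniusType (h.Ψ.functor.map φ) → S₁.IsFrobeniusType φ)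
    {A : S₁.C} (hA : S₂.IsFrobeniusTrivial (h.Ψ.functor.obj A)) : S₁.IsFrobeniusTrivial A := by
  obtain ⟨ζ, hζ⟩ := hA
  let Φe : End A ≃* End (h.Ψ.functor.obj A) := h.Ψ.fullyFaithfulFunctor.mulEquivEnd A
  refine ⟨Φe.symm.toMonoidHom.comp ζ, fun n => ?_⟩
  obtain ⟨hdeg, hbi, hft⟩ := hζ n
  have hmap : h.Ψ.functor.map (Φe.symm (ζ n)) = ζ n := Φe.apply_symm_apply (ζ n)
  refine ⟨?_, h.isBaseIdentity_of_map (φ := Φe.symm (ζ n)) (by rw [hmap]; exact hbi),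
    hrefl (Φe.symm (ζ n)) (by rw [hmap]; exact hft)⟩
  have e := h3.1 (Φe.symm (ζ n))
  rw [hmap] at e
  exact e.symm.trans hdeg

/-- **T44-L15r ⇐ T44-L03, the Frobenius-type clause of [FrdI] Thm 3.4 for `Ψ⁻¹` (reflection), "`C₂` is a
Frobenioid", and T44-L15b**: the witnesses `A' → Ψ(A)`, `A' → A''` of Def 4.1 (iii)(a) in `C₂` are moved
into the essential image of `Ψ` along the counit and pulled back through the fully faithful `Ψ`; the `N`-th
root of (b) is pulled back through `ψ_A`. [cite: MochizukiEtTh2009, Thm 4.4 p.95] -/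
theorem Thm44Hyp.reflectsSaturated_of (h : Thm44Hyp S₁ S₂)
    (ψ : ∀ A : S₁.C, S₁.biratUnits A ≃* S₂.biratUnits (h.Ψ.functor.obj A))
    (h3 : h.PreservesFrobeniusStructure)
    (hrefl : ∀ ⦃A B : S₁.C⦄ (φ : A ⟶ B), S₂.IsFrobeniusType (h.Ψ.functor.map φ) → S₁.IsFrobeniusType φ)
    (hF₂ : PreFrobenioid.IsFrobenioid S₂.F) (h15 : h.PreservesNHSaturatedBsFld) : h.ReflectsSaturated ψ := by
  intro A N f hA₁ hf₁ hsat
  obtain ⟨A₂', A₂'', s₁, s₂, hs₁, hs₂, hft, hNH⟩ := hsat.cond_a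
  obtain ⟨g₂, hg₂⟩ := hsat.cond_b
  let e' : h.Ψ.functor.obj (h.Ψ.inverse.obj A₂') ≅ A₂' := h.Ψ.counitIso.app A₂'
  let e'' : h.Ψ.functor.obj (h.Ψ.inverse.obj A₂'') ≅ A₂'' := h.Ψ.counitIso.app A₂''
  let t₁ : h.Ψ.inverse.obj A₂' ⟶ A := h.Ψ.functor.preimage (e'.hom ≫ s₁)
  let t₂ : h.Ψ.inverse.obj A₂' ⟶ h.Ψ.inverse.obj A₂'' := h.Ψ.functor.preimage (e'.hom ≫ s₂ ≫ e''.inv)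
  have ht₁ : h.Ψ.functor.map t₁ = e'.hom ≫ s₁ := h.Ψ.functor.map_preimage _
  have ht₂ : h.Ψ.functor.map t₂ = e'.hom ≫ s₂ ≫ e''.inv := h.Ψ.functor.map_preimage _
  have hft₁ : S₁.IsFrobeniusTrivial (h.Ψ.inverse.obj A₂'') :=
    h.isFrobeniusTrivial_of_map h3 hrefl (PreFrobenioid.IsFrobeniusTrivial.of_iso S₂.F hF₂ e''.symm hft)
  refine ⟨hA₁, hf₁, ⟨_, _, t₁, t₂, ?_, ?_, hft₁, (h15 _ A₂'' N hft₁ ⟨e''⟩).2 hNH⟩, ⟨(ψ A).symm g₂, ?_⟩⟩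
  · refine h.isPreStep_of_map h3 ?_
    rw [ht₁]
    exact PreFrobenioid.IsPreStep.comp S₂.F (PreFrobenioid.isPreStep_of_isIso S₂.F e'.hom) hs₁
  · refine h.isPreStep_of_map h3 ?_
    rw [ht₂]
    exact PreFrobenioid.IsPreStep.comp S₂.F (PreFrobenioid.isPreStep_of_isIso S₂.F e'.hom)
      (PreFrobenioid.IsPreStep.comp S₂.F hs₂ (PreFrobenioid.isPreStep_of_isIso S₂.F e''.inv))
  · apply (ψ A).injective
    rw [map_pow, MulEquiv.apply_symm_apply, hg₂]

/-- **Thm 4.4 (iii) (saturation clause, v5) from the printed proof's inputs**: T44-L03 ([FrdI] Thm 3.4 at `Ψ`),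
the Frobenius-type clause of [FrdI] Thm 3.4 at `Ψ⁻¹`, "`C₂` is a Frobenioid" ([FrdI] Thm 5.2 (ii)) and
T44-L15b ([FrdII] Def 2.2 (ii) / [AbsAnab] Lem 1.3.8). [cite: MochizukiEtTh2009, Thm 4.4 p.95] -/
theorem Thm44Hyp.thm44_iii_of_inputs (h : Thm44Hyp S₁ S₂)
    (ψ : ∀ A : S₁.C, S₁.biratUnits A ≃* S₂.biratUnits (h.Ψ.functor.obj A))
    (h3 : h.PreservesFrobeniusStructure)
    (hrefl : ∀ ⦃A B : S₁.C⦄ (φ : A ⟶ B), S₂.IsFrobeniusType (h.Ψ.functor.map φ) → S₁.IsFrobeniusType φ)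
    (hF₂ : PreFrobenioid.IsFrobenioid S₂.F) (h15 : h.PreservesNHSaturatedBsFld) : Thm44_iii h ψ :=
  h.thm44_iii_of ψ (h.preservesSaturated_of ψ h3 h15) (h.reflectsSaturated_of ψ h3 hrefl hF₂ h15)

end BiKummerSetting

end Literature.AnabelianGeometry.EtaleTheta
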